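import Mathlib
import Summits.PneNP.PneNP.Theorems.AeaCutRectanglesTransversalEngine

/-!
# OrbitalGate — the structural half of walls B10 / N1 (BarrierNotesP4g11 §4.6, §4.9(o))

Crux workfile for `Summit.PneNP.PneNP.Theses.AeaCutRectangles.FoolingMeasure` (stmt-PneNP-19727), seat pnp-ideate-p4 g11.
FRONTIER restricted-model rung (AEA cut rectangles); nothing here bears on P vs NP.

Vocabulary of the transversal engine (`tg`, `gammaMinus`): a unit system is `π : ι → Finset (Sym2 V)` over a frame `W`;
D1 = every transversal graph `tg W t` (`t i ∈ π i`) is NOT 3-colourable; D2 = every `gammaMinus W π i` (frame + all units but `i`) IS.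

* §1 `pairwise_disjoint_of_D1_D2`: under D1 + D2 no edge lies in two different units.  Hence an orbital design has at most
  `min(|G·q|, |G·q'|)` units, and wall B8 (`3T ≤ m + 2`) becomes the parity-free degree floor `deg(G·q) ≥ 3·log₂ n + 6C − 4/n`.
* §2 `exists_avoid_of_card_lt` / `colorable_of_few_hits`: the pigeonhole behind the ORBITAL HITTING LEMMA — if for every symmetry index
  `g` the graph `E minus {a g, b g}` is 3-colourable and `F ⊆ E` is hit by fewer than `|G|` of the `a g, b g`, then `F` is 3-colourable.
* §3 `colorable_erase_map`: transport of D2 along an `E`-preserving vertex permutation.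
* §4 `orbital_hitting`: §2 + §3 — from D2 at ONE unit `(q, q')` and a family of `E`-preserving permutations `σ g`, every
  `F ⊆ E` with `#{g | σ g • q ∈ F} + #{g | σ g • q' ∈ F} < |G|` is 3-colourable.  With `F = G·q − e` this is the gate
  "`W ∪ (G·q − e)` 3-colourable" that the censuses of §4.8–4.9 run.
* §5 `not_colorable_erase_of_core(_orbit)` (N2, no small cores): if a non-3-colourable `K ⊆ E` misses a pair `f`, then `E − σ•f` is
  non-3-colourable for every `E`-preserving `σ`; so in an orbital design every 4-critical subgraph of `W ∪ O` contains all of `O`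
  (the local odd-wheel test "dead(LW)" of the censuses is the computable instance).
-/

set_option linter.dupNamespace false
set_option autoImplicit false

namespace Summit.PneNP.PneNP.Cruxes.FoolingMeasure.OrbitalGate

open Finset SimpleGraph
open Summit.PneNP.PneNP.Theorems.AeaCutRectanglesTransversalEngine (tg gammaMinus mem_tg mem_gammaMinus)

/-! ### §1 Exact systems share no pair -/

/-- Under D1 and D2 two different units have disjoint edge sets. -/
theorem pairwise_disjoint_of_D1_D2 {V ι : Type*} [DecidableEq V] [Fintype ι] [DecidableEq ι]
    (W : Finset (Sym2 V)) (π : ι → Finset (Sym2 V)) (hne : ∀ i, (π i).Nonempty)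
    (hD1 : ∀ t : ι → Sym2 V, (∀ i, t i ∈ π i) →
      ¬ (fromEdgeSet (↑(tg W t) : Set (Sym2 V))).Colorable 3)
    (hD2 : ∀ i, (fromEdgeSet (↑(gammaMinus W π i) : Set (Sym2 V))).Colorable 3) :
    ∀ i j, i ≠ j → Disjoint (π i) (π j) := by
  intro i j hij
  rw [Finset.disjoint_left]
  intro e hei hej
  classical
  -- the transversal choosing `e` at unit `i` and anything elsewhere lies inside `Γ − πᵢ`
  let t : ι → Sym2 V := fun l => if l = i then e else (hne l).choose
  have ht : ∀ l, t l ∈ π l := by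
    intro l
    by_cases hl : l = i
    · subst hl; simp [t, hei]
    · simp [t, hl, (hne l).choose_spec]
  have hsub : (↑(tg W t) : Set (Sym2 V)) ⊆ ↑(gammaMinus W π i) := by
    intro f hf
    rw [Finset.mem_coe, mem_tg] at hf
    rw [Finset.mem_coe, mem_gammaMinus]
    rcases hf with hf | ⟨l, rfl⟩
    · exact Or.inl hf
    · by_cases hl : l = i
      · subst hl; exact Or.inr ⟨j, fun h => hij h.symm, by simp [t, hej]⟩
      · exact Or.inr ⟨l, hl, by simpa [t, hl] using (hne l).choose_spec⟩
  exact hD1 t ht ((hD2 i).mono_left (fromEdgeSet_mono hsub))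

/-- Consequently the units inject into the edges: `∑ᵢ |πᵢ| = |⋃ᵢ πᵢ|`; with 2-edge units, `2m ≤ |W ∪ P| − |W|`-type floors follow. -/
theorem sum_card_eq_card_biUnion_of_D1_D2 {V ι : Type*} [DecidableEq V] [Fintype ι] [DecidableEq ι]
    (W : Finset (Sym2 V)) (π : ι → Finset (Sym2 V)) (hne : ∀ i, (π i).Nonempty)
    (hD1 : ∀ t : ι → Sym2 V, (∀ i, t i ∈ π i) →
      ¬ (fromEdgeSet (↑(tg W t) : Set (Sym2 V))).Colorable 3)
    (hD2 : ∀ i, (fromEdgeSet (↑(gammaMinus W π i) : Set (Sym2 V))).Colorable 3) :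
    ∑ i, (π i).card = (univ.biUnion π).card := by
  rw [Finset.card_biUnion]
  intro i _ j _ hij
  exact pairwise_disjoint_of_D1_D2 W π hne hD1 hD2 i j hij

/-! ### §2 The pigeonhole -/

/-- If fewer than `|G|` indices are "bad" for one of two reasons, some index is good for both. -/
theorem exists_avoid_of_card_lt {G : Type*} [Fintype G] (P Q : G → Prop) [DecidablePred P] [DecidablePred Q]
    (h : (univ.filter P).card + (univ.filter Q).card < Fintype.card G) : ∃ g, ¬ P g ∧ ¬ Q g := by
  classical
  by_contra hcon
  push Not at hcon
  have hcov : (univ : Finset G) ⊆ univ.filter P ∪ univ.filter Q := by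
    intro g _
    rw [Finset.mem_union, Finset.mem_filter, Finset.mem_filter]
    by_cases hP : P g
    · exact Or.inl ⟨Finset.mem_univ _, hP⟩
    · exact Or.inr ⟨Finset.mem_univ _, hcon g hP⟩
  have := (Finset.card_le_card hcov).trans (Finset.card_union_le _ _)
  rw [Finset.card_univ] at this
  omega

/-- ORBITAL HITTING LEMMA, abstract form.  `a g, b g` are the two pairs of the unit indexed by `g`; if removing them from `E`
always leaves a 3-colourable graph, then every `F ⊆ E` hit by fewer than `|G|` of them (counted with multiplicity) is 3-colourable. -/
theorem colorable_of_few_hits {V G : Type*} [DecidableEq V] [Fintype G] (E F : Finset (Sym2 V)) (a b : G → Sym2 V)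
    (hD2 : ∀ g, (fromEdgeSet (↑((E.erase (a g)).erase (b g)) : Set (Sym2 V))).Colorable 3) (hF : F ⊆ E)
    (hcount : (univ.filter fun g => a g ∈ F).card + (univ.filter fun g => b g ∈ F).card < Fintype.card G) :
    (fromEdgeSet (↑F : Set (Sym2 V))).Colorable 3 := by
  classical
  obtain ⟨g, hga, hgb⟩ := exists_avoid_of_card_lt (fun g => a g ∈ F) (fun g => b g ∈ F) hcount
  refine (hD2 g).mono_left (fromEdgeSet_mono ?_)
  intro e he
  rw [Finset.mem_coe] at he ⊢
  rw [Finset.mem_erase, Finset.mem_erase]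
  exact ⟨fun h => hgb (h ▸ he), fun h => hga (h ▸ he), hF he⟩

/-! ### §3 Transport along an `E`-preserving permutation -/

theorem map_symm_map {V : Type*} (σ : Equiv.Perm V) (e : Sym2 V) : Sym2.map σ.symm (Sym2.map σ e) = e := by
  induction e using Sym2.ind
  simp

theorem map_map_symm {V : Type*} (σ : Equiv.Perm V) (e : Sym2 V) : Sym2.map σ (Sym2.map σ.symm e) = e := by
  induction e using Sym2.ind
  simp

/-- If `σ` preserves `E`, a 3-colouring of `E − q − q'` transports to one of `E − σq − σq'`. -/
theorem colorable_erase_map {V : Type*} [DecidableEq V] (E : Finset (Sym2 V)) (σ : Equiv.Perm V)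
    (hσ : ∀ e, Sym2.map σ e ∈ E ↔ e ∈ E) (q q' : Sym2 V) {k : ℕ}
    (h : (fromEdgeSet (↑((E.erase q).erase q') : Set (Sym2 V))).Colorable k) :
    (fromEdgeSet (↑((E.erase (Sym2.map σ q)).erase (Sym2.map σ q')) : Set (Sym2 V))).Colorable k := by
  classical
  obtain ⟨C⟩ := h
  -- the map `v ↦ σ⁻¹ v` is a graph homomorphism from `E − σq − σq'` to `E − q − q'`
  let f : (fromEdgeSet (↑((E.erase (Sym2.map σ q)).erase (Sym2.map σ q')) : Set (Sym2 V))) →g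
      (fromEdgeSet (↑((E.erase q).erase q') : Set (Sym2 V))) :=
    { toFun := fun v => σ.symm v
      map_rel' := by
        intro u v huv
        rw [fromEdgeSet_adj] at huv ⊢
        obtain ⟨hmem, hne⟩ := huv
        rw [Finset.mem_coe, Finset.mem_erase, Finset.mem_erase] at hmem
        obtain ⟨h1, h2, hE⟩ := hmem
        refine ⟨?_, σ.symm.injective.ne hne⟩
        rw [Finset.mem_coe, Finset.mem_erase, Finset.mem_erase]
        have key : Sym2.map σ.symm s(u, v) = s(σ.symm u, σ.symm v) := by simp
        refine ⟨?_, ?_, ?_⟩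
        · intro hq
          apply h1
          have := congrArg (Sym2.map σ) hq
          rw [← key, map_map_symm] at this
          exact this.symm ▸ rfl
        · intro hq
          apply h2
          have := congrArg (Sym2.map σ) hq
          rw [← key, map_map_symm] at this
          exact this.symm ▸ rfl
        · rw [← key, ← hσ, map_map_symm]; exact hE }
  exact ⟨C.comp f⟩

/-! ### §4 The orbital hitting lemma -/

/-- **ORBITAL HITTING LEMMA.**  `E` = frame + all pairs; `σ g` (`g : G`) are `E`-preserving vertex permutations (the design's
symmetry); D2 at the unit `(q, q')`: `E − q − q'` is 3-colourable.  Then every `F ⊆ E` met by fewer than `|G|` of the translates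
`σ g • q`, `σ g • q'` is 3-colourable.  (For a group `G` acting with `E`, `W` invariant: `#{g | g•q ∈ F} = |F ∩ G·q|·|G_q|`, so
`F = W ∪ (G·q − e)` qualifies whenever pairs are unshared — the gate of BarrierNotesP4g11 §4.6.) -/
theorem orbital_hitting {V G : Type*} [DecidableEq V] [Fintype G] (E F : Finset (Sym2 V)) (σ : G → Equiv.Perm V)
    (hσ : ∀ g e, Sym2.map (σ g) e ∈ E ↔ e ∈ E) (q q' : Sym2 V)
    (hD2 : (fromEdgeSet (↑((E.erase q).erase q') : Set (Sym2 V))).Colorable 3) (hF : F ⊆ E)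
    (hcount : (univ.filter fun g => Sym2.map (σ g) q ∈ F).card + (univ.filter fun g => Sym2.map (σ g) q' ∈ F).card
      < Fintype.card G) :
    (fromEdgeSet (↑F : Set (Sym2 V))).Colorable 3 :=
  colorable_of_few_hits E F (fun g => Sym2.map (σ g) q) (fun g => Sym2.map (σ g) q')
    (fun g => colorable_erase_map E (σ g) (hσ g) q q' hD2) hF hcount

/-- The single-edge gate: if moreover only the identity index fixes `q` inside `F`'s complement… — concretely: if the translates
`σ g • q` are pairwise distinct (`|G_q| = 1`), all `σ g • q'` avoid `F`, and `F` omits at least one translate of `q`, then `F` is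
3-colourable.  (`F = W ∪ (G·q − e)` in an AGL(1,p) design with odd `h`.) -/
theorem gate_single_edge {V G : Type*} [DecidableEq V] [Fintype G] [DecidableEq G] (E F : Finset (Sym2 V))
    (σ : G → Equiv.Perm V) (hσ : ∀ g e, Sym2.map (σ g) e ∈ E ↔ e ∈ E) (q q' : Sym2 V)
    (hD2 : (fromEdgeSet (↑((E.erase q).erase q') : Set (Sym2 V))).Colorable 3) (hF : F ⊆ E)
    (hq' : ∀ g, Sym2.map (σ g) q' ∉ F) (g₀ : G) (hmiss : Sym2.map (σ g₀) q ∉ F) :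
    (fromEdgeSet (↑F : Set (Sym2 V))).Colorable 3 := by
  classical
  refine orbital_hitting E F σ hσ q q' hD2 hF ?_
  have h0 : (univ.filter fun g => Sym2.map (σ g) q' ∈ F) = ∅ := by
    ext g; simp [hq' g]
  rw [h0, Finset.card_empty, add_zero]
  apply Finset.card_lt_card
  refine ⟨Finset.filter_subset _ _, fun hsub => hmiss ?_⟩
  simpa using hsub (Finset.mem_univ g₀)

/-! ### §5 No small cores (N2, BarrierNotesP4g11 §4.6) -/

/-- Push a `k`-colouring forward along a permutation: if `σ` maps every pair of `K` into `F`, a `k`-colouring of `F` gives one of `K`. -/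
theorem colorable_of_map_into {V : Type*} [DecidableEq V] (K F : Finset (Sym2 V)) (σ : Equiv.Perm V)
    (hKF : ∀ x ∈ K, Sym2.map σ x ∈ F) {k : ℕ}
    (h : (fromEdgeSet (↑F : Set (Sym2 V))).Colorable k) :
    (fromEdgeSet (↑K : Set (Sym2 V))).Colorable k := by
  classical
  obtain ⟨C⟩ := h
  let f : (fromEdgeSet (↑K : Set (Sym2 V))) →g (fromEdgeSet (↑F : Set (Sym2 V))) :=
    { toFun := fun v => σ v
      map_rel' := by
        intro u v huv
        rw [fromEdgeSet_adj] at huv ⊢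
        obtain ⟨hmem, hne⟩ := huv
        rw [Finset.mem_coe] at hmem ⊢
        refine ⟨?_, σ.injective.ne hne⟩
        have key : Sym2.map σ s(u, v) = s(σ u, σ v) := by simp
        rw [← key]
        exact hKF _ hmem }
  exact ⟨C.comp f⟩

/-- **NO SMALL CORES (N2).**  `E` = frame + pairs, `σ` an `E`-preserving permutation, `K ⊆ E` a non-3-colourable subgraph
(a "core"), and `f ∈ E` a pair MISSED by `K`.  Then deleting the translate `σ • f` from `E` does not make it 3-colourable:
`σ` carries `K` into `E − σ•f`.  In an orbital design (`G` transitive on the orbital `O ∋ f`, every `σ g` preserving `E = W ∪ O`)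
this says: if some 4-chromatic `K ⊆ W ∪ O` misses a single pair of `O`, then `W ∪ (O − e)` is non-3-colourable for EVERY `e ∈ O`,
so D2 fails — every 4-critical subgraph of `W ∪ O` must contain all of `O` (the odd-wheel / local test "dead(LW)" of §4.9). -/
theorem not_colorable_erase_of_core {V : Type*} [DecidableEq V] (E K : Finset (Sym2 V)) (σ : Equiv.Perm V)
    (hσ : ∀ e, Sym2.map σ e ∈ E ↔ e ∈ E) (hK : K ⊆ E)
    (hKnc : ¬ (fromEdgeSet (↑K : Set (Sym2 V))).Colorable 3) (f : Sym2 V) (hfK : f ∉ K) :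
    ¬ (fromEdgeSet (↑(E.erase (Sym2.map σ f)) : Set (Sym2 V))).Colorable 3 := by
  classical
  intro h
  apply hKnc
  refine colorable_of_map_into K (E.erase (Sym2.map σ f)) σ ?_ h
  intro x hx
  rw [Finset.mem_erase]
  refine ⟨fun hxf => hfK ?_, (hσ x).2 (hK hx)⟩
  have := congrArg (Sym2.map σ.symm) hxf
  rw [map_symm_map, map_symm_map] at this
  exact this ▸ hx

/-- N2 for a family of symmetries: if the translates `σ g • f` (`g : G`) cover the orbital `O ⊆ E` and some core `K ⊆ E` misses `f`,
then no single deletion `E − e`, `e ∈ O`, is 3-colourable. -/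
theorem not_colorable_erase_of_core_orbit {V G : Type*} [DecidableEq V] (E K O : Finset (Sym2 V)) (σ : G → Equiv.Perm V)
    (hσ : ∀ g e, Sym2.map (σ g) e ∈ E ↔ e ∈ E) (hK : K ⊆ E)
    (hKnc : ¬ (fromEdgeSet (↑K : Set (Sym2 V))).Colorable 3) (f : Sym2 V) (hfK : f ∉ K)
    (hO : ∀ e ∈ O, ∃ g, Sym2.map (σ g) f = e) (e : Sym2 V) (he : e ∈ O) :
    ¬ (fromEdgeSet (↑(E.erase e) : Set (Sym2 V))).Colorable 3 := by
  obtain ⟨g, rfl⟩ := hO e he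
  exact not_colorable_erase_of_core E K (σ g) (hσ g) hK hKnc f hfK

end Summit.PneNP.PneNP.Cruxes.FoolingMeasure.OrbitalGate
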